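import Summits.AtomisticToContinuum.Crystallization.Theorems.OverbindingBudgetAffineRunCutSheetCross
import Literature.Geometry.DiscreteGeometry.BondGraph

/-!
# `OverbindingBudget` / crux `RobustDefectLimitWindows` (stmt-AtomisticToContinuum-31280) — «RunCut»: THE HARD-CORE ENDGAME of crossing exclusion

Support file (lens-4 g88, part 19; memo `g88/memo/UNIAX-g88.md` §3, order (2c)).  The discrete crossing argument (tree `…RunCutSheetCross`: a basal
chain of the foreign sheet `Σ_b` that starts below and ends above the plane of the own sheet `Σ_a` has two CONSECUTIVE sites straddling it) is closed
here WITHOUT the local layer-rigidity fact and without any common length scale: the straddling step is a basal bond, hence at most `1.0011×` the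
own nearest-neighbour distance of EITHER of its endpoints (tree `…RunCutSheetLetter.basal_step_record` (B),(D)), so the endpoint `b⋆` nearer to the
plane has height `≤ (σλ/2)·ν_{b⋆} ≤ (σλ/2)·dist(b⋆, a⋆)` for the net site `a⋆` of `Σ_a` under it (hard core of `b⋆`; `σ` = height rate of a basal
bond of `Σ_b` over the plane of `Σ_a`, `λ = 1.0011`); with `Σ_a` flat to `ε·ν_{a⋆}` and covering to `κ·ν_{a⋆}` this gives
`dist(b⋆,a⋆)² ≤ ((σλ/2)·dist + εν)² + (κν)²`, which forces `dist(b⋆,a⋆) < ν_{a⋆}` as soon as `(σλ/2 + ε)² + κ² < 1` — contradicting the hard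
core of `a⋆` (`nearestDist ≤ dist`).  Record numbers `(24/25 + 1/400, 1.0011, 1/10, 3/4)`: `0.90 < 1` (LOCAL endgame: the plane is the
local tangent plane of `Σ_a` at a net site next to the event, so `ε` is the flatness over `≤ 13` steps, not over the access walk).

* `no_site_in_hardcore` — ★ `0 < ν ≤ q`, `q² ≤ (αq + εν)² + (κν)²`, `(α+ε)² + κ² < 1` ⇒ `False`;
* `abs_inner_le_of_tilt` — a vector `v` almost in a plane with unit normal `N` (`|⟪N,v⟫| ≤ μ‖v‖`) has `|⟪n,v⟫| ≤ (s + μ)‖v‖` against any unit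
  `n` with `|⟪N,n⟫| ≥ c₀`, `1 − c₀² ≤ s²` (two `{111}` families: `|cos| = 1/3`, record `c₀ = 7/25`, `s = 24/25`): the per-step height bound of a
  basal chain of `Σ_b` over the plane of `Σ_a`;
* `crossing_pair_absurd` — ★★ the endgame for one straddling pair (site form, any configuration `y : ι → V`; parametric in the height rate `σ`,
  bond factor `λ`, flatness `ε`, covering `κ` under `(σλ/2 + ε)² + κ² < 1`);
* `crossing_chain_absurd` — ★★ chain form: a basal chain of `Σ_b` from below to above the plane, with a net site of `Σ_a` under every chain site ⇒ `False`;
* `crossing_numbers_record` — the record instance `(σ, λ, ε, κ) = (24/25 + 1/400, 1.0011, 1/10, 3/4)`: `0.90 < 1`, and `1 − (7/25)² ≤ (24/25)²`;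
* `hex_support` — planar kernel for the covering walks of the sheet engine: `|x + y/2|, |x/2 + y|, |y/2 − x/2| ≤ h ⇒ x² + xy + y² ≤ (4/3)h²`
  (the regular hexagon with inradius `h` has circumradius `2h/√3`; hexagonal coordinates).
[this file: 0 definitions, 6 theorems; imports tree `…RunCutSheetCross` (Mathlib-only) + `Literature…BondGraph` (`nearestDist`); standard axioms]
-/

namespace Summit.AtomisticToContinuum.Crystallization.Theorems.OverbindingBudgetAffineRunCutCrossCore

open scoped InnerProductSpace
open Summit.AtomisticToContinuum.Crystallization.Theorems.OverbindingBudgetAffineRunCutSheetCross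
open Literature.Geometry.DiscreteGeometry

/-- ★ **No site in the hard core (parametric numeric heart).**  If `0 < ν ≤ q` and `q² ≤ (αq + εν)² + (κν)²` with `α, ε ≥ 0` and
`(α + ε)² + κ² < 1`, contradiction (`κ` enters only squared).  (At `q = ν` the inequality fails by the numeric hypothesis, and `q² − (αq+εν)²` grows with `q ≥ ν` because
`1 − α² ≥ 2αε`.) [this file · kind: proof] -/
theorem no_site_in_hardcore {α ε κ ν q : ℝ} (hα : 0 ≤ α) (hε : 0 ≤ ε) (hnum : (α + ε) ^ 2 + κ ^ 2 < 1)
    (hν : 0 < ν) (hq : ν ≤ q) (hle : q ^ 2 ≤ (α * q + ε * ν) ^ 2 + (κ * ν) ^ 2) : False := by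
  have hα1 : α < 1 := by nlinarith [sq_nonneg κ, sq_nonneg ε]
  have h1 : 0 ≤ 1 - α ^ 2 - 2 * α * ε := by nlinarith [sq_nonneg κ, sq_nonneg ε]
  -- `(1-α²) q - 2αε ν ≥ (1-α²-2αε) ν ≥ 0`
  have h2 : (1 - α ^ 2 - 2 * α * ε) * ν ≤ (1 - α ^ 2) * q - 2 * α * ε * ν := by
    have : 0 ≤ (1 - α ^ 2) * (q - ν) := mul_nonneg (by nlinarith) (by linarith)
    linarith
  have h3 : 0 ≤ (1 - α ^ 2) * q - 2 * α * ε * ν := le_trans (mul_nonneg h1 hν.le) h2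
  -- `D(q) = q((1-α²)q - 2αεν) - (ε²+κ²)ν² ≥ (1-(α+ε)²-κ²) ν² > 0`
  have h4 : ν * ((1 - α ^ 2 - 2 * α * ε) * ν) ≤ q * ((1 - α ^ 2) * q - 2 * α * ε * ν) :=
    mul_le_mul hq h2 (mul_nonneg h1 hν.le) (le_trans hν.le hq)
  have h5 : 0 < (1 - (α + ε) ^ 2 - κ ^ 2) * ν ^ 2 := mul_pos (by linarith) (pow_pos hν 2)
  nlinarith [h4, h5]

/-- ★ **Height change along an almost-in-plane step.**  `N`, `n` unit vectors with `|⟪N, n⟫| ≥ c₀ ≥ 0`; a vector `v` with `|⟪N, v⟫| ≤ μ‖v‖`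
(a basal bond of a sheet with local normal `N`, up to affine distortion) satisfies `|⟪n, v⟫| ≤ (s + μ)·‖v‖` for any `s ≥ 0` with
`1 − c₀² ≤ s²` (`n = ⟪N,n⟫N + w`, `‖w‖² = 1 − ⟪N,n⟫²`).  Record use: `c₀ = 7/25`, `s = 24/25`, `μ = 1/400`. [this file · kind: proof] -/
theorem abs_inner_le_of_tilt {V : Type*} [NormedAddCommGroup V] [InnerProductSpace ℝ V] {N n v : V} {c₀ s μ : ℝ}
    (hN : ‖N‖ = 1) (hn : ‖n‖ = 1) (hc₀ : 0 ≤ c₀) (hc : c₀ ≤ |⟪N, n⟫_ℝ|) (hs : 0 ≤ s) (hsc : 1 - c₀ ^ 2 ≤ s ^ 2)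
    (hv : |⟪N, v⟫_ℝ| ≤ μ * ‖v‖) : |⟪n, v⟫_ℝ| ≤ (s + μ) * ‖v‖ := by
  set c : ℝ := ⟪N, n⟫_ℝ with hcdef
  set w : V := n - c • N with hw
  have hcn : ⟪n, N⟫_ℝ = c := by rw [hcdef, real_inner_comm]
  -- `‖w‖² = 1 - c²`
  have hw2 : ‖w‖ ^ 2 = 1 - c ^ 2 := by
    rw [hw, @norm_sub_sq_real, inner_smul_right, hcn, norm_smul, mul_pow, Real.norm_eq_abs, sq_abs, hN, hn]; ring
  have hc1 : |c| ≤ 1 := by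
    have := abs_real_inner_le_norm N n; rw [hN, hn] at this; simpa using this
  have hwn : ‖w‖ ≤ s := by
    have h64 : c₀ ^ 2 ≤ c ^ 2 := by rw [← sq_abs c]; exact pow_le_pow_left₀ hc₀ hc 2
    have h2 : ‖w‖ ^ 2 ≤ s ^ 2 := by rw [hw2]; linarith
    exact (pow_le_pow_iff_left₀ (norm_nonneg w) hs two_ne_zero).1 h2
  -- `⟪n, v⟫ = ⟪w, v⟫ + c ⟪N, v⟫`
  have hsplit : ⟪n, v⟫_ℝ = ⟪w, v⟫_ℝ + c * ⟪N, v⟫_ℝ := by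
    rw [hw, inner_sub_left, inner_smul_left]; simp only [conj_trivial]; ring
  have hwv : |⟪w, v⟫_ℝ| ≤ s * ‖v‖ :=
    le_trans (abs_real_inner_le_norm w v) (mul_le_mul_of_nonneg_right hwn (norm_nonneg v))
  have hcv : |c * ⟪N, v⟫_ℝ| ≤ μ * ‖v‖ := by
    rw [abs_mul]; exact le_trans (mul_le_mul hc1 hv (abs_nonneg _) zero_le_one) (by linarith)
  rw [hsplit]
  exact le_trans (abs_add_le _ _) (by linarith)

variable {V : Type*} [NormedAddCommGroup V] [InnerProductSpace ℝ V] {ι : Type*}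

/-- ★★ **THE HARD-CORE ENDGAME (one straddling pair).**  Configuration `y : ι → V`; plane `{x | ⟪n, x − q₀⟫ = 0}` with unit normal `n`; two sites
`b`, `b′` on opposite sides (heights `≤ 0` and `≥ 0`) whose height difference is at most `σ×` their distance, the distance being at most
`λ×` the own nearest-neighbour distance of each (a basal bond read from both ends); under each of them a net site (`a ≠ b` resp. `a′ ≠ b′`)
of positive scale, flat to `εν` and laterally within `κν` in its own scale `ν`; numbers with `(σλ/2 + ε)² + κ² < 1`.  Contradiction: the
endpoint nearer to the plane sits inside the hard core of its net site. [this file · kind: proof] -/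
theorem crossing_pair_absurd {y : ι → V} {n q₀ : V} (hn : ‖n‖ = 1) {σ lam ε κ : ℝ} (hσ : 0 ≤ σ) (hlam0 : 0 ≤ lam) (hε : 0 ≤ ε)
    (hnum : (σ * lam / 2 + ε) ^ 2 + κ ^ 2 < 1) {b b' a a' : ι}
    (hb : ⟪n, y b - q₀⟫_ℝ ≤ 0) (hb' : 0 ≤ ⟪n, y b' - q₀⟫_ℝ)
    (hst : ⟪n, y b' - q₀⟫_ℝ - ⟪n, y b - q₀⟫_ℝ ≤ σ * dist (y b) (y b'))
    (hlam : dist (y b) (y b') ≤ lam * nearestDist y b) (hlam' : dist (y b) (y b') ≤ lam * nearestDist y b')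
    (hab : a ≠ b) (hνa : 0 < nearestDist y a) (ha : |⟪n, y a - q₀⟫_ℝ| ≤ ε * nearestDist y a)
    (hlat : ‖(y b - y a) - ⟪n, y b - y a⟫_ℝ • n‖ ≤ κ * nearestDist y a)
    (hab' : a' ≠ b') (hνa' : 0 < nearestDist y a') (ha' : |⟪n, y a' - q₀⟫_ℝ| ≤ ε * nearestDist y a')
    (hlat' : ‖(y b' - y a') - ⟪n, y b' - y a'⟫_ℝ • n‖ ≤ κ * nearestDist y a') : False := by
  have hα : 0 ≤ σ * lam / 2 := by positivity
  rcases min_abs_le_half_of_sign_change hb hb' hst with h | h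
  · -- `b` is the near endpoint; its net site is `a`
    set q : ℝ := dist (y b) (y a) with hqdef
    have hνb : nearestDist y b ≤ q := nearestDist_le_dist y hab
    have hνaq : nearestDist y a ≤ q := by rw [hqdef, dist_comm]; exact nearestDist_le_dist y hab.symm
    have hx : |⟪n, y b - q₀⟫_ℝ| ≤ σ * lam / 2 * q := by
      have h1 : σ * dist (y b) (y b') ≤ σ * (lam * q) := mul_le_mul_of_nonneg_left (le_trans hlam (by nlinarith)) hσ
      exact le_trans h (by nlinarith)
    have key := dist_sq_le_of_height_of_lateral hn hx ha hlat
    rw [← dist_eq_norm, ← hqdef] at key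
    exact no_site_in_hardcore hα hε hnum hνa hνaq (by simpa [mul_comm, mul_left_comm, mul_assoc] using key)
  · -- `b′` is the near endpoint; its net site is `a′`
    set q : ℝ := dist (y b') (y a') with hqdef
    have hνb : nearestDist y b' ≤ q := nearestDist_le_dist y hab'
    have hνaq : nearestDist y a' ≤ q := by rw [hqdef, dist_comm]; exact nearestDist_le_dist y hab'.symm
    have hx : |⟪n, y b' - q₀⟫_ℝ| ≤ σ * lam / 2 * q := by
      have h1 : σ * dist (y b) (y b') ≤ σ * (lam * q) := mul_le_mul_of_nonneg_left (le_trans hlam' (by nlinarith)) hσ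
      exact le_trans h (by nlinarith)
    have key := dist_sq_le_of_height_of_lateral hn hx ha' hlat'
    rw [← dist_eq_norm, ← hqdef] at key
    exact no_site_in_hardcore hα hε hnum hνa' hνaq (by simpa [mul_comm, mul_left_comm, mul_assoc] using key)

/-- ★★ **THE HARD-CORE ENDGAME (chain form).**  A chain `p 0, …, p k` of sites whose signed heights over the plane start negative and end
nonnegative, consecutive heights rising by at most `σ×` the step length, each step at most `λ×` the own scale of both its endpoints, and under
EVERY chain site a net site (distinct from it, positive scale, flat to `εν`, laterally within `κν`), `(σλ/2 + ε)² + κ² < 1`: contradiction.  This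
is how the sheet engine consumes two complete non-parallel h-sheets that cross inside the certified region. [this file · kind: proof] -/
theorem crossing_chain_absurd {y : ι → V} {n q₀ : V} (hn : ‖n‖ = 1) {σ lam ε κ : ℝ} (hσ : 0 ≤ σ) (hlam0 : 0 ≤ lam) (hε : 0 ≤ ε)
    (hnum : (σ * lam / 2 + ε) ^ 2 + κ ^ 2 < 1) (p : ℕ → ι) (k : ℕ)
    (h0 : ⟪n, y (p 0) - q₀⟫_ℝ < 0) (hk : 0 ≤ ⟪n, y (p k) - q₀⟫_ℝ)
    (hstep : ∀ i, i < k → ⟪n, y (p (i + 1)) - q₀⟫_ℝ - ⟪n, y (p i) - q₀⟫_ℝ ≤ σ * dist (y (p i)) (y (p (i + 1))) ∧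
      dist (y (p i)) (y (p (i + 1))) ≤ lam * nearestDist y (p i) ∧
      dist (y (p i)) (y (p (i + 1))) ≤ lam * nearestDist y (p (i + 1)))
    (hnet : ∀ i, i ≤ k → ∃ a : ι, a ≠ p i ∧ 0 < nearestDist y a ∧ |⟪n, y a - q₀⟫_ℝ| ≤ ε * nearestDist y a ∧
      ‖(y (p i) - y a) - ⟪n, y (p i) - y a⟫_ℝ • n‖ ≤ κ * nearestDist y a) : False := by
  obtain ⟨i, hik, hi0, hi1⟩ := exists_index_sign_change_below (fun i => ⟪n, y (p i) - q₀⟫_ℝ) k h0 hk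
  obtain ⟨hs, hl, hl'⟩ := hstep i hik
  obtain ⟨a, hab, hνa, ha, hlat⟩ := hnet i hik.le
  obtain ⟨a', hab', hνa', ha', hlat'⟩ := hnet (i + 1) (Nat.succ_le_of_lt hik)
  exact crossing_pair_absurd hn hσ hlam0 hε hnum hi0.le hi1 hs hl hl' hab hνa ha hlat hab' hνa' ha' hlat'

/-- The record instance of the numeric side condition: height rate `σ = 24/25 + 1/400` (`|cos| ≥ 7/25` between the two local normals, tilt
slack `μ = 1/400`), bond factor `λ = 1.0011`, local flatness `ε = 1/10`, covering `κ = 3/4`: `(σλ/2 + ε)² + κ² = 0.901… < 1`; and the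
tilt-lemma side condition `1 − (7/25)² ≤ (24/25)²` (an equality). [this file · kind: proof] -/
theorem crossing_numbers_record :
    (((24 : ℝ) / 25 + 1 / 400) * (10011 / 10000) / 2 + 1 / 10) ^ 2 + (3 / 4) ^ 2 < 1 ∧ (1 : ℝ) - (7 / 25) ^ 2 ≤ (24 / 25) ^ 2 := by
  constructor <;> norm_num

/-- ★ **Hexagon support (planar kernel of the covering walks).**  In hexagonal coordinates (`e = x u₁ + y u₂`, `‖u₁‖ = ‖u₂‖ = 1`, `⟪u₁,u₂⟫ = 1/2`,
so `‖e‖² = x² + xy + y²` and `⟪e,u₁⟫ = x + y/2`, `⟪e,u₂⟫ = x/2 + y`, `⟪e,u₂ − u₁⟫ = y/2 − x/2`): if the three hexagon diameters read at most `h`,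
then `‖e‖² ≤ (4/3) h²` — the regular hexagon with inradius `h` has circumradius `2h/√3`; equivalently one of the six basal directions makes an
angle `≤ 30°` with any in-plane direction. [this file · kind: proof] -/
theorem hex_support {x y h : ℝ} (h1 : |x + y / 2| ≤ h) (h2 : |x / 2 + y| ≤ h) (h3 : |y / 2 - x / 2| ≤ h) :
    x ^ 2 + x * y + y ^ 2 ≤ 4 / 3 * h ^ 2 := by
  -- with `p = x + y/2`, `r = x/2 + y`: `x² + xy + y² = (4/3)(p² − pr + r²)` and `p² − pr + r² ≤ h²`
  set p : ℝ := x + y / 2 with hp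
  set r : ℝ := x / 2 + y with hr
  have hpr : y / 2 - x / 2 = r - p := by rw [hp, hr]; ring
  rw [hpr] at h3
  have hid : x ^ 2 + x * y + y ^ 2 = 4 / 3 * (p ^ 2 - p * r + r ^ 2) := by rw [hp, hr]; ring
  rw [hid]
  have hp' := abs_le.mp h1; have hr' := abs_le.mp h2; have hd := abs_le.mp h3
  have hh : 0 ≤ h := le_trans (abs_nonneg _) h1
  have key : p ^ 2 - p * r + r ^ 2 ≤ h ^ 2 := by
    have hp2 : p ^ 2 ≤ h ^ 2 := by rw [← sq_abs p]; exact pow_le_pow_left₀ (abs_nonneg p) h1 2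
    have hr2 : r ^ 2 ≤ h ^ 2 := by rw [← sq_abs r]; exact pow_le_pow_left₀ (abs_nonneg r) h2 2
    have hd2 : (r - p) ^ 2 ≤ h ^ 2 := by rw [← sq_abs (r - p)]; exact pow_le_pow_left₀ (abs_nonneg _) h3 2
    rcases le_or_gt 0 (p * r) with hs | hs
    · -- same sign: `p² − pr + r² ≤ max(p², r²) ≤ h²` (`min² ≤ |p||r| = pr`)
      have hpr : p * r = |p| * |r| := by rw [← abs_mul, abs_of_nonneg hs]
      rcases le_or_gt (p ^ 2) (r ^ 2) with hle | hle
      · have hab : |p| ≤ |r| := sq_le_sq.mp hle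
        have : p ^ 2 ≤ p * r := by
          rw [hpr, ← sq_abs p, sq]; exact mul_le_mul_of_nonneg_left hab (abs_nonneg p)
        linarith
      · have hab : |r| ≤ |p| := sq_le_sq.mp hle.le
        have : r ^ 2 ≤ p * r := by
          rw [hpr, ← sq_abs r, sq, mul_comm |p| |r|]; exact mul_le_mul_of_nonneg_left hab (abs_nonneg r)
        linarith
    · -- opposite signs: `p² − pr + r² = (r − p)² + pr ≤ (r − p)²`
      nlinarith [hd2]
  nlinarith [key]

end Summit.AtomisticToContinuum.Crystallization.Theorems.OverbindingBudgetAffineRunCutCrossCore
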